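/-
COR-CM (cell pub-hodgecm2, stage 2 of the Hodge ladder) — count-neutral kernel combinatorics (seat prover-pub-hodgecm2-b23-g51-0, binder
prover b23, gen 51; lane SYLOW TRANSFER, claim HOME/INBOX.md l.23329; blanket `Census/SylowTransfer*` l.23357).  Theorems only, in seat b09's
intrinsic model (consumed BY NAME, nothing restated); no definition, no certificate, no `decide`, no named fact, no geometry, no `sorry`.
`Interfaces.lean` (C1), every E term, B01 and `Transposition/*` are untouched.
HONEST FRAMING: `HC_CM` is NOT proved, here or anywhere in the tree; nothing here is a period or a headline.
-/
import Summits.HodgeConjecture.CorCM.Census.SylowTransferEightOdd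

/-!
# Sylow transfer, VIII: SPECTATOR DOUBLING settled for cyclic-Sylow cores and for cores of order `4·odd`

Gen 47ʼs SPECTATOR DOUBLING (`Census/Spectator*`: `G ⊃ H ∋ c` of index two, `x ∉ H` a CENTRAL involution, i.e. `G = H × ⟨x⟩` — the Galois CM
field `F₀·k` with `k` real quadratic) was left with two-sided bounds and the conjecture `μ(H × C₂, c) = φ₂` («spectator fibre exactness»,
`HOME/pub-hodgecm2-b23/SPECTATOR.md` §3b).  The Sylow transfer settles it for two classes of cores `H`, with NO generating family of `H` needed:
* **`isLeast_card_gfaces_generate_fibreTwo_of_spectator_cyclic_sylow`**: `H` has a cyclic Sylow `2`-subgroup `⟨u⟩` of order `2ᵏ ≥ 4` and `|H| = 2ᵏ·m`,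
  `m > 1` odd — then the Sylow `2`-subgroup of `G` is `⟨u⟩ × ⟨x⟩ ≅ ℤ/2ᵏ × ℤ/2` and part VI applies: `μ(G, c) = φ₂(G, c)` for EVERY central involution.
* **`isLeast_card_gfaces_generate_fibreTwo_of_spectator_four_mul_odd`** (`G : Type`): `|H| = 4·odd` — then `|G| = 8·odd` and the Sylow `2`-subgroup
  `P` of `G` is abelian (`P ∩ H` has order `4`, `P = (P ∩ H) × ⟨x⟩` with `x` central), so part VII applies: `μ(G, c) = φ₂(G, c)` for EVERY `c`.
(Cores of order `2·odd` double to `|G| = 4·odd`, part III.)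
All [folklore] bookkeeping over [Pohlmann1968, Thm 1] in the reading of [Milne1999, Prop. 2.1].

## References
* [Pohlmann1968] H. Pohlmann, Algebraic cycles on abelian varieties of complex multiplication type, Ann. of Math. 88 (1968), Thm 1.
* [Milne1999] J. S. Milne, Lefschetz motives and the Tate conjecture, Compositio Math. 117 (1999), Prop. 2.1, p. 54.
-/

namespace Summit.HodgeConjecture.CorCM.Census.SylowTransfer

open Finset
open Summit.HodgeConjecture.CorCM.Prior.AllgGroup.RfwfAllgGroup
open Summit.HodgeConjecture.CorCM.Census.BlockParity
open Summit.HodgeConjecture.CorCM.Census.Coinvariant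

noncomputable section

variable {G : Type*} [Group G] [Fintype G] [DecidableEq G]

/-! ## §1 Cyclic-Sylow cores -/

/-- **SPECTATOR DOUBLING OF A CYCLIC-SYLOW CORE**: `H ≤ G` of index two, `x ∉ H` a central involution, `u ∈ H` of order `2ᵏ ≥ 4` with
`|H| = 2ᵏ·m`, `m > 1` odd ⟹ `μ(G, c) = φ₂(G, c)` for every central involution `c ≠ 1` of `G`. [folklore] -/
theorem isLeast_card_gfaces_generate_fibreTwo_of_spectator_cyclic_sylow (c : G) (H : Subgroup G) (hH : H.index = 2) {x : G} (hxH : x ∉ H)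
    (hx2 : x * x = 1) (hxcen : ∀ g : G, g * x = x * g) {u : G} (huH : u ∈ H) {k m : ℕ} (hord : orderOf u = 2 ^ k) (hk : 2 ≤ k)
    (hcardH : Nat.card H = 2 ^ k * m) (hm : Odd m) (hm1 : m ≠ 1) (hc2 : c * c = 1) (hc1 : c ≠ 1) (hcen : ∀ y : G, y * c = c * y) :
    IsLeast {n : ℕ | ∃ S : Finset (CMF G c →₀ ℤ), (↑S ⊆ gfaceSet G c hc2) ∧ S.card = n ∧
      hodgeSpan c hc2 ≤ Submodule.span ℤ (pairSet c) ⊔ Submodule.span ℤ (translates c S)} (fibreTwo c hc2) := by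
  have hG : Fintype.card G = 2 ^ (k + 1) * m := by
    have h := H.card_mul_index
    rw [hcardH, hH, Nat.card_eq_fintype_card] at h
    rw [← h, pow_succ]; ring
  have hx1 : x ≠ 1 := fun h => hxH (h ▸ H.one_mem)
  have hxu : x ∉ Subgroup.zpowers u := fun h => hxH ((Subgroup.zpowers_le.mpr huH) h)
  exact isLeast_card_gfaces_generate_fibreTwo_of_cyclicTimesTwo_elements c (hxcen u) hord hk hx2 hx1 hxu hG hm hm1 hc2 hc1 hcen

/-! ## §2 Cores of order `4·odd` -/

omit [DecidableEq G] in
/-- In `G = H × ⟨x⟩` (`x` a central involution outside the index-two subgroup `H`) with `|H| = 4·odd`, a Sylow `2`-subgroup of `G` is abelian.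
[folklore] -/
theorem sylow_comm_of_spectator_four_mul_odd (H : Subgroup G) (hH : H.index = 2) {x : G} (hxH : x ∉ H) (hx2 : x * x = 1)
    (hxcen : ∀ g : G, g * x = x * g) {m : ℕ} (hcardH : Nat.card H = 4 * m) (hm : Odd m) (P : Sylow 2 G) :
    ∀ a ∈ (P : Subgroup G), ∀ b ∈ (P : Subgroup G), a * b = b * a := by
  haveI : Fact (Nat.Prime 2) := ⟨Nat.prime_two⟩
  have hG : Fintype.card G = 8 * m := by
    have h := H.card_mul_index
    rw [hcardH, hH, Nat.card_eq_fintype_card] at h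
    omega
  have hP8 := (card_sylow_eq_eight P hG hm).1
  have hxP : x ∈ (P : Subgroup G) := TypeStabiliser.mem_sylow_of_central x hx2 hxcen P
  -- `P ∩ H` has index two in `P`, hence order `4`, hence is abelian
  set P₀ : Subgroup (P : Subgroup G) := H.subgroupOf (P : Subgroup G) with hP₀
  have hidx : P₀.index = 2 := by
    refine Subgroup.index_eq_two_iff.mpr ⟨⟨x, hxP⟩, fun b => ?_⟩
    rw [hP₀, Subgroup.mem_subgroupOf, Subgroup.mem_subgroupOf, Subgroup.coe_mul, Subgroup.mul_mem_iff_of_index_two hH]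
    by_cases hb : (b : G) ∈ H
    · exact Or.inr ⟨hb, fun h => hxH (h.mp hb)⟩
    · exact Or.inl ⟨⟨fun h => absurd h hb, fun h => absurd h hxH⟩, hb⟩
  have hcard0 : Nat.card P₀ = 2 ^ 2 := by
    have h := P₀.card_mul_index
    rw [hidx, hP8] at h
    omega
  have hcomm0 : ∀ a b : P₀, a * b = b * a := fun a b => (IsPGroup.isMulCommutative_of_card_eq_prime_sq hcard0).is_comm.comm a b
  have key : ∀ a ∈ (P : Subgroup G), a ∈ H → ∀ b ∈ (P : Subgroup G), b ∈ H → a * b = b * a := fun a ha haH b hb hbH => by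
    have h := hcomm0 ⟨⟨a, ha⟩, Subgroup.mem_subgroupOf.mpr haH⟩ ⟨⟨b, hb⟩, Subgroup.mem_subgroupOf.mpr hbH⟩
    exact congrArg (fun z : P₀ => ((z : (P : Subgroup G)) : G)) h
  -- every element of `P` is in `H` or in `H·x`
  have hsplit : ∀ a ∈ (P : Subgroup G), a ∉ H → a * x ∈ H := fun a _ haH =>
    (Subgroup.mul_mem_iff_of_index_two hH).mpr ⟨fun h => absurd h haH, fun h => absurd h hxH⟩
  have hcancel : ∀ a b : G, (a * x) * b = b * (a * x) → a * b = b * a := fun a b e => by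
    have e' : a * b * x = b * a * x := by
      calc a * b * x = a * (b * x) := mul_assoc _ _ _
        _ = a * (x * b) := by rw [hxcen b]
        _ = a * x * b := (mul_assoc _ _ _).symm
        _ = b * (a * x) := e
        _ = b * a * x := (mul_assoc _ _ _).symm
    exact mul_right_cancel e'
  intro a ha b hb
  by_cases haH : a ∈ H <;> by_cases hbH : b ∈ H
  · exact key a ha haH b hb hbH
  · exact (hcancel b a (key _ (mul_mem hb hxP) (hsplit b hb hbH) a ha haH)).symm
  · exact hcancel a b (key _ (mul_mem ha hxP) (hsplit a ha haH) b hb hbH)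
  · have e := key _ (mul_mem ha hxP) (hsplit a ha haH) _ (mul_mem hb hxP) (hsplit b hb hbH)
    -- `(a x)(b x) = (b x)(a x)` ⟹ `a b = b a`
    apply hcancel a b
    have e1 : a * x * (b * x) = a * x * b * x := (mul_assoc _ _ _).symm
    have e2 : b * x * (a * x) = b * (a * x) * x := by
      rw [mul_assoc, mul_assoc, mul_assoc, ← hxcen (a * x), mul_assoc]
    rw [e1, e2] at e
    exact mul_right_cancel e

/-- **SPECTATOR DOUBLING OF A CORE OF ORDER `4·odd`** (`G : Type`): `H ≤ G` of index two with `|H| = 4·odd`, `x ∉ H` a central involution ⟹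
`μ(G, c) = φ₂(G, c)` for every central involution `c ≠ 1` of `G` (part VII; the Sylow `2`-subgroup of `G` is abelian). [folklore] -/
theorem isLeast_card_gfaces_generate_fibreTwo_of_spectator_four_mul_odd {G : Type} [Group G] [Fintype G] [DecidableEq G] (c : G)
    (H : Subgroup G) (hH : H.index = 2) {x : G} (hxH : x ∉ H) (hx2 : x * x = 1) (hxcen : ∀ g : G, g * x = x * g) {m : ℕ}
    (hcardH : Nat.card H = 4 * m) (hm : Odd m) (hc2 : c * c = 1) (hc1 : c ≠ 1) (hcen : ∀ y : G, y * c = c * y) :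
    IsLeast {n : ℕ | ∃ S : Finset (CMF G c →₀ ℤ), (↑S ⊆ gfaceSet G c hc2) ∧ S.card = n ∧
      hodgeSpan c hc2 ≤ Submodule.span ℤ (pairSet c) ⊔ Submodule.span ℤ (translates c S)} (fibreTwo c hc2) := by
  haveI : Fact (Nat.Prime 2) := ⟨Nat.prime_two⟩
  have hG : Fintype.card G = 8 * m := by
    have h := H.card_mul_index
    rw [hcardH, hH, Nat.card_eq_fintype_card] at h
    omega
  obtain ⟨P⟩ := (inferInstance : Nonempty (Sylow 2 G))
  exact isLeast_card_gfaces_generate_fibreTwo_of_card_eq_eight_mul_odd_comm' c hG hm P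
    (sylow_comm_of_spectator_four_mul_odd H hH hxH hx2 hxcen hcardH hm P) hc2 hc1 hcen

end

end Summit.HodgeConjecture.CorCM.Census.SylowTransfer
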